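import Summits.Parity.GeneralizedHardyLittlewood.Theorems.PrimeLevelFamEdgeIdeaDeltasPeterssonLayersHeart
import HarnessLib

/-!
# Route `PrimeLevelFamEdge` — TYPED IDEA DELTAS, deck 21c: K-L17-2 «PETERSSON LAYERS» v3 concluded — §5c THE THREE-BAND
# HEART (CORE `SubUpper ρ_c`, ρ_c = 3(Δ'−1)+1/10 · GENERIC BAND `SubBand ρ_c ρ_P`, ρ_P = max(5Δ'−4, 8Δ'−8)+1/10 · FAR
# `SubFar ρ_P`; glue `subUpper_of_upper_band`, transport `tailNearFar_transport`, SEVEN-piece glue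
# `MomentsBeyondDiagonal_of_sevenSplitBands`) and §6 costume-test witnesses (the EMPTY cut).
# LANDING NOTE (typer ls-idea-typ-1 gen 3): seat ls-idea-lens-17 `Split_PeterssonLayers.v3.lean` sha16 90790e3a81ab6eae
# l.510–782 VERBATIM up to the namespace relabel (see deck 21a); the registered line on stmt-Parity-20007 composes exactly
# `MomentsBeyondDiagonal_of_sevenSplitBands` with its seven stubs.  HONESTY: glue and bookkeeping only; no piece of K_A,
# no moment asymptotic and no exceptional-zero theorem (no Landau–Siegel / Siegel-zero exclusion, no Theorem 1–2 of
# arXiv:2211.02515, no repaired Margin232) is proved here; `stub_band` is conjecture-grade, `stub_farP` a located theorem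
# applied in pencil; typed ≠ proved.
-/

noncomputable section

open scoped MatrixGroups Real
open CongruenceSubgroup Complex Finset Polynomial MeasureTheory
open Literature.NumberTheory.EllipticCurves.ModularForms
open Literature.NumberTheory.LFunctions

namespace Summit.Parity.GeneralizedHardyLittlewood.Theorems.PrimeLevelFamEdgeIdeaDeltas.PeterssonLayers

open Summit.Parity.GeneralizedHardyLittlewood.Theses.PrimeLevelFamEdge
open Summit.Parity.GeneralizedHardyLittlewood.Theorems.PrimeLevelFamEdgeIdeaDeltas.PairsSplit
  (FirstMomentBeyond SubFirst subFirst_of_momentsBeyondDiagonal)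

/-! ## §5c. THE THREE-BAND HEART (v3, 2026-08-28 — lens-6 §v20 (20.2c)(β) OFFER ACCEPTED; B b140 rider (ii)
«BN-7a LAYER LEDGER»). At COUNT grade (absolute values, completion, hybrid large sieve) the heart `SubUpper ρ_W` is
atomic (census `Lines/conductor_layers_dead.md`, variants (a)–(g)); at ℓ² + PRINT grade two seams inside it are
certified: (T1′) the OPERATOR-NORM FLOOR `N_r ≥ c√ϑ_r` (`ϑ_r ≍ √Y/r`, `Y = q̂^{2(Δ'−1)}`) — no ℓ²-coefficient-blind
bilinear bound closes a layer `r < κ′Y^{3/2} = κ′q̂^{3(Δ'−1)}`: the CORE is structure-mandatory — and PRINT from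
`ρ_P = max(1+5λ, 8λ) + ε` on (`λ = Δ'−1`): Pascadi, arXiv:2511.08445, Thm 7.1 with `(d,d′,e) = (r,1,q)`, `f = r`,
terms `rϑ⁴c = q̂²Y²/r²`, `rϑ² = Y/r`, `f/d² = 1/r`, saving `c^{o(1)}(q̂²Y²/r² + Y/r + 1/r)^{1/6} ≤ Y^{−1/2}(log)^{−C}` once
`r ≥ max(q̂^{1+ε}Y^{5/2}, Y⁴q̂^{ε})` ((F1) re-derived in pencil by lens-6, by this seat, locate asked of A; side
condition `N ≤ M ≤ c ⟸ r ≥ √Y`). CUTS OF RECORD (v3): `ρ_c := 3(Δ'−1) + 1/10` (core; the `1/10` covers `κ′(log)^{2C}`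
and puts the band strictly inside the regime where the perfect-orthogonality edge `2√ϑ = 2Y^{−1/2}q̂^{−1/20}`
suffices with a power to spare) and `ρ_P := max(5Δ'−4, 8Δ'−8) + 1/10` (print; the `1/10` turns `c^{o(1)}` into a
power margin). PIECES: CORE `SubUpper ρ_c` (layers `2 ≤ r ≤ q̂^{ρ_c}`: the crux proper, ⊇ BN-18's residence `r ∈ Dℕ`,
`D ≤ q̂^{ρ_c}`, and the faces `c = 2q, 3q, …`; with the RUNG `r = 1` this is BN-7a entire), GENERIC BAND
`SubBand ρ_c ρ_P` (layers `q̂^{ρ_c} < r ≤ q̂^{ρ_P}`: character-blind, conjecture-grade — «balanced bilinear Kloosterman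
forms at composite modulus `rq` beat Parseval by `Y^{−1/2}(log)^{−C}` at relative length `ϑ ∈ [q̂^{−1.1−4λ}, q̂^{−0.1−2λ}]`,
`θ = log A/log c ∈ (≈0.65, ≈0.95)`»; parents Shkredov 2021 (prime modulus), Pascadi 2025 (partial saving on
`r > q̂^{1+2λ}`); lens-6 t3′), FAR `SubFar ρ_P` (Pascadi on `(ρ_P, ρ_W]` ∪ Weil beyond: print + pencil). GLUE (proved):
`SubUpper ρ₁ → SubBand ρ₁ ρ₂ → SubUpper ρ₂` for `0 ≤ ρ₁ ≤ ρ₂` on `(1, ∞)` (disjoint layer ranges, `subOf_of_add`), hence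
the SEVEN-piece split `SubFirst → SubDiag → SubRung → SubUpper ρ_c → SubBand ρ_c ρ_P → TailNearFar ρ_P → SubFar ρ_P → K_A`;
and the TRANSPORT `TailNearFar ρ₁ → TailNearFar ρ₂` for cuts `≤ 8` on `(1, 3/2]` (the identification's content does
not depend on the cut: `tail ρ + far ρ = Q^h − D + Σ_{r ≤ q⁸} K_r`), so the v2 stub `stub_ident` (cut `ρ_W`) and the v3
stub `stub_identP` (cut `ρ_P`) are interchangeable. No K_A bound is claimed; a located theorem applied in pencil proves
no stub. -/

section Bands

variable (q : ℕ) [NeZero q]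

/-- **BAND(ρ₁, ρ₂) = the layers `⌊q̂^{ρ₁(Δ')}⌋ < r ≤ ⌊q̂^{ρ₂(Δ')}⌋`** (explicit; cusp-form-free). -/
def band (ρ₁ ρ₂ : ℝ → ℝ) (P Q : ℝ[X]) (Δ' : ℝ) : ℂ :=
  ∑ r ∈ Icc (layerCount q ρ₁ Δ' + 1) (layerCount q ρ₂ Δ'), layer q P Q Δ' r

/-- `⌊q̂^{ρ}⌋` is monotone in the cut (for `q ≥ 64`, where `q̂ > 1`). -/
theorem layerCount_mono {q : ℕ} [NeZero q] (hq : 64 ≤ q) {ρ₁ ρ₂ : ℝ → ℝ} {Δ' : ℝ} (h : ρ₁ Δ' ≤ ρ₂ Δ') :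
    layerCount q ρ₁ Δ' ≤ layerCount q ρ₂ Δ' := by
  unfold layerCount
  exact Nat.floor_le_floor (Real.rpow_le_rpow_of_exponent_le (one_lt_qhat hq).le h)

/-- **`UPPER(ρ₂) = UPPER(ρ₁) + BAND(ρ₁, ρ₂)`** whenever `1 ≤ ⌊q̂^{ρ₁}⌋ ≤ ⌊q̂^{ρ₂}⌋` (disjoint layer ranges). -/
theorem upper_eq_upper_add_band (ρ₁ ρ₂ : ℝ → ℝ) (P Q : ℝ[X]) (Δ' : ℝ)
    (h₁ : 1 ≤ layerCount q ρ₁ Δ') (h₁₂ : layerCount q ρ₁ Δ' ≤ layerCount q ρ₂ Δ') :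
    upper q ρ₂ P Q Δ' = upper q ρ₁ P Q Δ' + band q ρ₁ ρ₂ P Q Δ' := by
  unfold upper band
  have hU : Icc 2 (layerCount q ρ₂ Δ') =
      Icc 2 (layerCount q ρ₁ Δ') ∪ Icc (layerCount q ρ₁ Δ' + 1) (layerCount q ρ₂ Δ') := by
    ext r
    simp only [mem_Icc, mem_union]
    omega
  have hD : Disjoint (Icc 2 (layerCount q ρ₁ Δ')) (Icc (layerCount q ρ₁ Δ' + 1) (layerCount q ρ₂ Δ')) := by
    rw [Finset.disjoint_left]
    intro r hr hr'
    simp only [mem_Icc] at hr hr'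
    omega
  rw [hU, sum_union hD]

/-- `HEART(ρ) + FAR(ρ) = Σ_{1 ≤ r ≤ q⁸} K_r` whenever `⌊q̂^{ρ}⌋ ≤ q⁸`: the cut disappears from the sum. -/
theorem heart_add_farLayers (ρ : ℝ → ℝ) (P Q : ℝ[X]) (Δ' : ℝ) (h : layerCount q ρ Δ' ≤ q ^ 8) :
    heart q ρ P Q Δ' + farLayers q ρ P Q Δ' = ∑ r ∈ Icc 1 (q ^ 8), layer q P Q Δ' r := by
  unfold heart farLayers
  have hU : Icc 1 (q ^ 8) = Icc 1 (layerCount q ρ Δ') ∪ Icc (layerCount q ρ Δ' + 1) (q ^ 8) := by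
    ext r
    simp only [mem_Icc, mem_union]
    omega
  have hD : Disjoint (Icc 1 (layerCount q ρ Δ')) (Icc (layerCount q ρ Δ' + 1) (q ^ 8)) := by
    rw [Finset.disjoint_left]
    intro r hr hr'
    simp only [mem_Icc] at hr hr'
    omega
  rw [hU, sum_union hD]

/-- Hence `TAIL(ρ) + FAR(ρ)` does not depend on the cut: `= Q^h − D + Σ_{r ≤ q⁸} K_r`. -/
theorem tail_add_farLayers (ρ : ℝ → ℝ) (P Q : ℝ[X]) (Δ' : ℝ) (h : layerCount q ρ Δ' ≤ q ^ 8) :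
    tail q ρ P Q Δ' + farLayers q ρ P Q Δ' =
      KMV2000.QhPQ q P Q (KMV2000.qhat q ^ Δ') - diagPart q P Q Δ' + ∑ r ∈ Icc 1 (q ^ 8), layer q P Q Δ' r := by
  unfold tail
  rw [← heart_add_farLayers q ρ P Q Δ' h]
  ring

/-- A cut `ρ(Δ') ≤ 8` keeps at most `q⁸` layers (for `q ≥ 64`: `q̂ = √q/2π ≤ q`). -/
theorem layerCount_le_pow_eight {q : ℕ} [NeZero q] (hq : 64 ≤ q) {ρ : ℝ → ℝ} {Δ' : ℝ} (h : ρ Δ' ≤ 8) :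
    layerCount q ρ Δ' ≤ q ^ 8 := by
  unfold layerCount
  have h1 : (1 : ℝ) < KMV2000.qhat q := one_lt_qhat hq
  have hq1 : (1 : ℝ) ≤ (q : ℝ) := by exact_mod_cast (le_trans (by norm_num) hq : 1 ≤ q)
  have hqhat_le : KMV2000.qhat q ≤ (q : ℝ) := by
    unfold KMV2000.qhat
    have hsqrt : Real.sqrt (q : ℝ) ≤ (q : ℝ) := by
      rw [Real.sqrt_le_left (by positivity)]
      nlinarith
    have hpi : (1 : ℝ) ≤ 2 * Real.pi := by linarith [Real.pi_gt_three]
    calc Real.sqrt (q : ℝ) / (2 * Real.pi) ≤ Real.sqrt (q : ℝ) / 1 :=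
          div_le_div_of_nonneg_left (Real.sqrt_nonneg _) one_pos hpi
      _ = Real.sqrt (q : ℝ) := div_one _
      _ ≤ (q : ℝ) := hsqrt
  have step1 : KMV2000.qhat q ^ ρ Δ' ≤ KMV2000.qhat q ^ (8 : ℝ) :=
    Real.rpow_le_rpow_of_exponent_le h1.le h
  have step2 : KMV2000.qhat q ^ (8 : ℝ) ≤ (q : ℝ) ^ (8 : ℝ) :=
    Real.rpow_le_rpow (le_trans zero_le_one h1.le) hqhat_le (by norm_num)
  have step3 : (q : ℝ) ^ (8 : ℝ) = ((q ^ 8 : ℕ) : ℝ) := by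
    rw [show (8 : ℝ) = ((8 : ℕ) : ℝ) by norm_num, Real.rpow_natCast]
    push_cast
    ring
  have : KMV2000.qhat q ^ ρ Δ' ≤ ((q ^ 8 : ℕ) : ℝ) := by
    calc KMV2000.qhat q ^ ρ Δ' ≤ KMV2000.qhat q ^ (8 : ℝ) := step1
      _ ≤ (q : ℝ) ^ (8 : ℝ) := step2
      _ = ((q ^ 8 : ℕ) : ℝ) := step3
  exact (Nat.floor_le_floor this).trans (Nat.floor_natCast _).le

end Bands

/-- **Sub_B(ρ₁, ρ₂) (the BAND piece):** the layers `q̂^{ρ₁} < r ≤ q̂^{ρ₂}` have the second-display shape with SOME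
level-free functional. Instance of record: the GENERIC BAND `SubBand rhoCore rhoP` (character-blind, conjecture-grade,
unprinted: t3′). -/
def SubBand (ρ₁ ρ₂ : ℝ → ℝ) : Prop := SubOf (fun q _ P Q Δ' ↦ band q ρ₁ ρ₂ P Q Δ')

/-- **BAND GLUE (proved): `SubUpper ρ₁ → SubBand ρ₁ ρ₂ → SubUpper ρ₂`** for cuts `0 ≤ ρ₁ ≤ ρ₂` beyond the diagonal. -/
theorem subUpper_of_upper_band (ρ₁ ρ₂ : ℝ → ℝ) (h0 : ∀ Δ' : ℝ, 1 < Δ' → 0 ≤ ρ₁ Δ')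
    (h12 : ∀ Δ' : ℝ, 1 < Δ' → ρ₁ Δ' ≤ ρ₂ Δ') :
    SubUpper ρ₁ → SubBand ρ₁ ρ₂ → SubUpper ρ₂ :=
  subOf_of_add (fun q _ P Q Δ' ↦ upper q ρ₂ P Q Δ') (fun q _ P Q Δ' ↦ upper q ρ₁ P Q Δ')
    (fun q _ P Q Δ' ↦ band q ρ₁ ρ₂ P Q Δ')
    (fun q _ P Q Δ' hΔ' hq ↦ upper_eq_upper_add_band q ρ₁ ρ₂ P Q Δ'
      (one_le_layerCount hq (h0 Δ' hΔ')) (layerCount_mono hq (h12 Δ' hΔ')))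

/-- **TRANSPORT OF THE IDENTIFICATION (proved): `TailNearFar ρ₁ → TailNearFar ρ₂`** for any two cuts that stay `≤ 8`
on the window `(1, 3/2]` — the identification's content (`tail + far = Q^h − D + Σ_{r ≤ q⁸} K_r`) is cut-free; the
window is shrunk to `≤ 3/2` and `q ≥ 64` inside the proof. -/
theorem tailNearFar_transport (ρ₁ ρ₂ : ℝ → ℝ)
    (h₁ : ∀ Δ' : ℝ, 1 < Δ' → Δ' ≤ 3 / 2 → ρ₁ Δ' ≤ 8) (h₂ : ∀ Δ' : ℝ, 1 < Δ' → Δ' ≤ 3 / 2 → ρ₂ Δ' ≤ 8) :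
    TailNearFar ρ₁ → TailNearFar ρ₂ := by
  rintro ⟨Δ₁, hΔ₁, H⟩
  refine ⟨min Δ₁ (3 / 2), lt_min hΔ₁ (by norm_num), ?_⟩
  intro P Q hP hQ Δ' hlo hhi
  obtain ⟨C, q₀, HH⟩ := H P Q hP hQ Δ' hlo (hhi.trans (min_le_left _ _))
  refine ⟨C, max q₀ 64, fun q _ hq hq₀ hM ↦ ?_⟩
  have h64 : 64 ≤ q := le_trans (le_max_right _ _) hq₀
  have h32 : Δ' ≤ 3 / 2 := hhi.trans (min_le_right _ _)
  have hb₁ := layerCount_le_pow_eight (q := q) h64 (h₁ Δ' hlo h32)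
  have hb₂ := layerCount_le_pow_eight (q := q) h64 (h₂ Δ' hlo h32)
  have key : tail q ρ₂ P Q Δ' - -farLayers q ρ₂ P Q Δ' = tail q ρ₁ P Q Δ' - -farLayers q ρ₁ P Q Δ' := by
    rw [sub_neg_eq_add, sub_neg_eq_add, tail_add_farLayers q ρ₂ P Q Δ' hb₂, tail_add_farLayers q ρ₁ P Q Δ' hb₁]
  rw [key]
  exact HH q hq (le_trans (le_max_left _ _) hq₀) hM

/-- **The CORE cut `ρ_c(Δ') = 3(Δ' − 1) + 1/10`** (= the v1 cut `ρ⋆` plus a `q̂^{1/10}` margin over the (T1′) floor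
`κ′Y^{3/2}(log q̂)^{2C}`). -/
def rhoCore : ℝ → ℝ := fun Δ' ↦ 3 * (Δ' - 1) + 1 / 10

/-- **The PRINT cut `ρ_P(Δ') = max(5Δ' − 4, 8Δ' − 8) + 1/10`** (Pascadi Thm 7.1 threshold `max(q̂Y^{5/2}, Y⁴)` plus a
`q̂^{1/10}` margin; branch `5Δ'−4` for `Δ' ≤ 4/3`). -/
def rhoP : ℝ → ℝ := fun Δ' ↦ max (5 * Δ' - 4) (8 * Δ' - 8) + 1 / 10

/-- The core cut is non-negative beyond the diagonal. -/
theorem rhoCore_nonneg (Δ' : ℝ) (h : 1 < Δ') : 0 ≤ rhoCore Δ' := by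
  unfold rhoCore
  linarith

/-- The v1 cut lies strictly below the core cut. -/
theorem rhoStar_lt_rhoCore (Δ' : ℝ) : rhoStar Δ' < rhoCore Δ' := by
  unfold rhoStar rhoCore
  linarith

/-- The core cut lies below the print cut beyond the diagonal. -/
theorem rhoCore_le_rhoP (Δ' : ℝ) (h : 1 < Δ') : rhoCore Δ' ≤ rhoP Δ' := by
  unfold rhoCore rhoP
  have := le_max_left (5 * Δ' - 4) (8 * Δ' - 8)
  linarith

/-- NON-VACUITY of the band: its log-width `ρ_P − ρ_c ≥ 2Δ' − 1 > 1`, so `BAND(ρ_c, ρ_P) ≠ ∅` for `q̂ ≥ 2`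
(indeed `⌊q̂^{ρ_P}⌋ ≥ ⌊q̂·q̂^{ρ_c}⌋ > ⌊q̂^{ρ_c}⌋`); `SubBand ρ_c ρ_P` is not the empty-sum triviality. -/
theorem rhoCore_add_one_lt_rhoP (Δ' : ℝ) (h : 1 < Δ') : rhoCore Δ' + 1 < rhoP Δ' := by
  unfold rhoCore rhoP
  have := le_max_left (5 * Δ' - 4) (8 * Δ' - 8)
  linarith

/-- The print cut is non-negative beyond the diagonal. -/
theorem rhoP_nonneg (Δ' : ℝ) (h : 1 < Δ') : 0 ≤ rhoP Δ' :=
  (rhoCore_nonneg Δ' h).trans (rhoCore_le_rhoP Δ' h)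

/-- On `(1, 8/5)` the print cut lies strictly below the Weil cut (at the least windows `Δ' → 1⁺`: `ρ_P → 1.1`,
`ρ_W → 2.5` — «half the wall in log-measure»). -/
theorem rhoP_lt_rhoWeil (Δ' : ℝ) (h₁ : 1 < Δ') (h₂ : Δ' < 8 / 5) : rhoP Δ' < rhoWeil Δ' := by
  unfold rhoP rhoWeil
  have : max (5 * Δ' - 4) (8 * Δ' - 8) < 4 * Δ' - 3 / 2 - 1 / 10 := max_lt (by linarith) (by linarith)
  linarith

/-- On the window `(1, 3/2]` the print cut is at most `8`. -/
theorem rhoP_le_eight (Δ' : ℝ) (h₁ : 1 < Δ') (h₂ : Δ' ≤ 3 / 2) : rhoP Δ' ≤ 8 := by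
  unfold rhoP
  have : max (5 * Δ' - 4) (8 * Δ' - 8) ≤ 4 := max_le (by linarith) (by linarith)
  linarith

/-- On the window `(1, 3/2]` the Weil cut is at most `8`. -/
theorem rhoWeil_le_eight (Δ' : ℝ) (h₁ : 1 < Δ') (h₂ : Δ' ≤ 3 / 2) : rhoWeil Δ' ≤ 8 := by
  unfold rhoWeil
  linarith

/-- The v2 identification stub (cut `ρ_W`) and the v3 one (cut `ρ_P`) are INTERCHANGEABLE (proved both ways). -/
theorem tailNearFar_rhoP_of_rhoWeil : TailNearFar rhoWeil → TailNearFar rhoP :=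
  tailNearFar_transport rhoWeil rhoP (fun Δ' h₁ h₂ ↦ rhoWeil_le_eight Δ' h₁ h₂) (fun Δ' h₁ h₂ ↦ rhoP_le_eight Δ' h₁ h₂)

/-- Transport of the identification from the print cut back to the Weil cut. -/
theorem tailNearFar_rhoWeil_of_rhoP : TailNearFar rhoP → TailNearFar rhoWeil :=
  tailNearFar_transport rhoP rhoWeil (fun Δ' h₁ h₂ ↦ rhoP_le_eight Δ' h₁ h₂) (fun Δ' h₁ h₂ ↦ rhoWeil_le_eight Δ' h₁ h₂)

/-- **SEVEN-PIECE GLUE at any two cuts `0 ≤ ρ₁ ≤ ρ₂` beyond the diagonal (proved):**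
`SubFirst → SubDiag → SubRung → SubUpper ρ₁ → SubBand ρ₁ ρ₂ → TailNearFar ρ₂ → SubFar ρ₂ → K_A`. -/
theorem MomentsBeyondDiagonal_of_sevenSplit (ρ₁ ρ₂ : ℝ → ℝ) (h0 : ∀ Δ' : ℝ, 1 < Δ' → 0 ≤ ρ₁ Δ')
    (h12 : ∀ Δ' : ℝ, 1 < Δ' → ρ₁ Δ' ≤ ρ₂ Δ') :
    SubFirst → SubDiag → SubRung → SubUpper ρ₁ → SubBand ρ₁ ρ₂ → TailNearFar ρ₂ → SubFar ρ₂ → KA :=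
  fun h₁ h₂ h₃ h₄ h₅ h₆ h₇ ↦
    MomentsBeyondDiagonal_of_sixSplit ρ₂ (fun Δ' hΔ' ↦ (h0 Δ' hΔ').trans (h12 Δ' hΔ')) h₁ h₂ h₃
      (subUpper_of_upper_band ρ₁ ρ₂ h0 h12 h₄ h₅) h₆ h₇

/-- **THE THREE-BAND SPLIT OF RECORD (v3, proved): CORE · GENERIC BAND · PRINT —**
`SubFirst → SubDiag → SubRung → SubUpper ρ_c → SubBand ρ_c ρ_P → TailNearFar ρ_P → SubFar ρ_P → K_A`. -/
theorem MomentsBeyondDiagonal_of_sevenSplitBands :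
    SubFirst → SubDiag → SubRung → SubUpper rhoCore → SubBand rhoCore rhoP → TailNearFar rhoP → SubFar rhoP → KA :=
  MomentsBeyondDiagonal_of_sevenSplit rhoCore rhoP rhoCore_nonneg rhoCore_le_rhoP

/-- The v2 six-piece split at the Weil cut is RECOVERED from the v3 pieces plus the print band `(ρ_P, ρ_W]`
(bookkeeping check: `SubUpper ρ_c → SubBand ρ_c ρ_P → SubBand ρ_P ρ_W → SubUpper ρ_W` on windows inside `(1, 8/5)` is
NOT claimed — the cuts cross at `Δ' = 8/5`; the seven-piece glue above needs no comparison of `ρ_P` with `ρ_W`). -/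
example : SubFirst → SubDiag → SubRung → SubUpper rhoWeil → TailNearFar rhoWeil → SubFar rhoWeil → KA :=
  MomentsBeyondDiagonal_of_sixSplitWeil

/-! ## §6. Costume-test witnesses: the schema `SubHeart ρ` has a trivially true member (the EMPTY cut), at which the
split degenerates to DIAGONAL / OFF-DIAGONAL and still decides K_A; the cuts `ρ⋆`, `ρ_W` lie strictly above it. -/

/-- The EMPTY cut `ρ ≡ −1`: no layer is kept once `q̂ > 1`. -/
def rhoEmpty : ℝ → ℝ := fun _ ↦ -1

/-- For `q ≥ 64`, `⌊q̂^{−1}⌋ = 0`. -/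
theorem layerCount_rhoEmpty {q : ℕ} [NeZero q] (hq : 64 ≤ q) (Δ' : ℝ) : layerCount q rhoEmpty Δ' = 0 := by
  unfold layerCount rhoEmpty
  have h1 : 1 < KMV2000.qhat q := one_lt_qhat hq
  have h0 : 0 < KMV2000.qhat q := zero_lt_one.trans h1
  have hlt : KMV2000.qhat q ^ (-1 : ℝ) < 1 := by
    rw [Real.rpow_neg h0.le, Real.rpow_one]
    exact inv_lt_one_of_one_lt₀ h1
  exact Nat.floor_eq_zero.mpr (by exact_mod_cast hlt)

/-- At the empty cut the heart VANISHES for `q ≥ 64`. -/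
theorem heart_rhoEmpty {q : ℕ} [NeZero q] (hq : 64 ≤ q) (P Q : ℝ[X]) (Δ' : ℝ) :
    heart q rhoEmpty P Q Δ' = 0 := by
  unfold heart
  rw [layerCount_rhoEmpty hq]
  simp

/-- `SubHeart rhoEmpty` is PROVABLE (`t = 0`, `C = 0`, `q₀ = 64`): the schema `SubHeart ρ` runs from trivially true
(no layer) upward, so the glue is NOT uniform in `ρ` — it genuinely consumes the complementary tail. -/
theorem subHeart_rhoEmpty : SubHeart rhoEmpty := by
  refine ⟨2, by norm_num, fun _ _ _ ↦ 0, ?_⟩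
  intro P Q _ _ Δ' _ _
  refine ⟨0, 64, fun q _ _ hq _ ↦ ?_⟩
  simp [heart_rhoEmpty hq]

/-- At the empty cut the tail is the whole OFF-DIAGONAL `Q^h − D` (for `q ≥ 64`). -/
theorem tail_rhoEmpty {q : ℕ} [NeZero q] (hq : 64 ≤ q) (P Q : ℝ[X]) (Δ' : ℝ) :
    tail q rhoEmpty P Q Δ' = KMV2000.QhPQ q P Q (KMV2000.qhat q ^ Δ') - diagPart q P Q Δ' := by
  unfold tail
  rw [heart_rhoEmpty hq, add_zero]

/-- The degenerate member: **DIAGONAL / OFF-DIAGONAL** — `SubFirst → SubDiag → SubTail rhoEmpty → K_A`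
(`SubTail rhoEmpty` = «the full off-diagonal `Q^h − D` has the printed shape»). -/
theorem momentsBeyondDiagonal_of_diag_offDiag :
    SubFirst → SubDiag → SubTail rhoEmpty → KA :=
  fun h₁ h₂ h₃ ↦ MomentsBeyondDiagonal_of_layerSplit rhoEmpty h₁ h₂ subHeart_rhoEmpty h₃

/-- The v1 cut keeps at least the rung for every `Δ' > 1` (`ρ⋆(Δ') > 0`; so does `ρ_W`, `rhoWeil_pos`) … -/
theorem rhoStar_pos {Δ' : ℝ} (h : 1 < Δ') : 0 < rhoStar Δ' := by
  unfold rhoStar; linarith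

/-- … and is EMPTY below the diagonal (`ρ⋆(Δ') < 0` for `Δ' < 1`): the heart is exactly what is new beyond `Δ = 1`. -/
theorem rhoStar_neg {Δ' : ℝ} (h : Δ' < 1) : rhoStar Δ' < 0 := by
  unfold rhoStar; linarith

/-- `K_A ⟹ SubFirst` (deck 15, by name): the first piece is a CONSEQUENCE of K_A used toward K_A. None of `SubDiag`,
`SubHeart ρ⋆`, `SubTail ρ⋆`, `SubRung`, `SubUpper ρ⋆` is a syntactic consequence of K_A (bc probes), nor implies it. -/
theorem subFirst_of_KA (h : MomentsBeyondDiagonal) : SubFirst := subFirst_of_momentsBeyondDiagonal h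

end Summit.Parity.GeneralizedHardyLittlewood.Theorems.PrimeLevelFamEdgeIdeaDeltas.PeterssonLayers

end
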